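import Summits.CriticalPhenomena.PercolationContinuityZ3.Theorems.PercNearOneGluingNoHeavyLowerTailQ44KernelPeeling

/-!
# Odd containment: the co-good parity criterion for GF(2) certificates (`Q44`, all `n`)

Support file for crux `stmt-CriticalPhenomena-4575` (master-family programme, quadratic four-point row `Q44`), seat
`prim-bnk-1` gen 27; memo `run/shared/lean/prim/prim-l12/FROM-prim-bnk-1-gen27-SINGLE-SOURCE-ANATOMY.md` §3.

`…Q44KernelPeeling` proves `#ℛ ≤ #𝔊` (`𝔊` an up-set of "goods") as soon as every nonempty subfamily `𝒮 ⊆ ℛ` has an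
ODD TARGET `T ∈ 𝔊` (a good containing an odd number of members), and supplies odd targets through the Kernel Lemma
(`KernelPeeling.exists_odd_good`): a kernel `K ⊆ M ∈ 𝒮` contained in NO OTHER member, all of whose differences `K \ S`
are co-goods.  The certificate searches of gen 27 (single-source packing) need two sharper forms, proved here:

* `exists_odd_good_of_oddCount` — the privacy hypothesis is only a PARITY hypothesis: it suffices that the number of
  members of `𝒮` containing `K` is odd (`K` need not lie in a member, and several members may contain it);
* `exists_odd_good_of_compl_mem` — in particular ANY co-good `K` (`Kᶜ ∈ 𝔊`) contained in an odd number of members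
  is a certificate (all `S ∪ Kᶜ ⊇ Kᶜ` are goods because `𝔊` is an up-set);
* `exists_compl_mem_oddCount_of_odd_good`, `odd_good_iff_oddCount` — and this is a CRITERION: by Möbius parity on the
  cube below `Tᶜ`, an odd target exists iff some co-good is contained in an odd number of members.  Equivalently
  (`card_le_card_of_cogoodOdd`): the inclusion rows of `ℛ` against `𝔊` are GF(2)-independent, hence `#ℛ ≤ #𝔊`, as soon as
  every nonempty subfamily contains, in an odd number of its members, a common co-good;
* `exists_odd_good_of_card_odd` — the degenerate certificate `K = ∅`: a subfamily of odd size always has the target `univ`.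

Pure finite combinatorics; no named facts, no sorries, standard axioms.
-/

namespace Summit.CriticalPhenomena.PercolationContinuityZ3.Theorems

namespace KernelPeeling

open Finset

variable {α : Type*} [DecidableEq α]

/-- **Parity double count.**  `∑_{R ⊆ K} #{S ∈ 𝒮 : S ∩ K ⊆ R} = ∑_{S ∈ 𝒮} (2 : ℕ) ^ (#K - #(S ∩ K))`, and the terms with
`K ⊆ S` are the odd ones; so if the number of members containing `K` is odd, some fibre `{S : S ∩ K ⊆ R}` is odd.
[this work] -/
theorem exists_odd_trace_of_oddCount (𝒮 : Finset (Finset α)) (K : Finset α)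
    (hodd : Odd #(𝒮.filter (fun S => K ⊆ S))) :
    ∃ R ∈ K.powerset, Odd #(𝒮.filter (fun S => S ∩ K ⊆ R)) := by
  by_contra hcon
  simp only [not_exists, not_and] at hcon
  have heven : ∀ R ∈ K.powerset, Even #(𝒮.filter (fun S => S ∩ K ⊆ R)) :=
    fun R hR => Nat.not_odd_iff_even.1 (hcon R hR)
  have hdc : ∑ R ∈ K.powerset, #(𝒮.filter (fun S => S ∩ K ⊆ R))
      = ∑ S ∈ 𝒮, #(K.powerset.filter (fun R => S ∩ K ⊆ R)) := by
    simp_rw [Finset.card_filter]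
    exact Finset.sum_comm
  have hpow : ∑ S ∈ 𝒮, #(K.powerset.filter (fun R => S ∩ K ⊆ R))
      = ∑ S ∈ 𝒮, (2 : ℕ) ^ (#K - #(S ∩ K)) := by
    refine Finset.sum_congr rfl ?_
    intro S _
    exact StaircaseKleitman.card_filter_powerset_superset (S ∩ K) K Finset.inter_subset_right
  -- split the sum according to `K ⊆ S`
  have hsplit : ∑ S ∈ 𝒮, (2 : ℕ) ^ (#K - #(S ∩ K))
      = ∑ S ∈ 𝒮.filter (fun S => K ⊆ S), (2 : ℕ) ^ (#K - #(S ∩ K))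
        + ∑ S ∈ 𝒮.filter (fun S => ¬ K ⊆ S), (2 : ℕ) ^ (#K - #(S ∩ K)) :=
    (Finset.sum_filter_add_sum_filter_not 𝒮 (fun S => K ⊆ S) (fun S => (2 : ℕ) ^ (#K - #(S ∩ K)))).symm
  have hin : ∑ S ∈ 𝒮.filter (fun S => K ⊆ S), (2 : ℕ) ^ (#K - #(S ∩ K)) = #(𝒮.filter (fun S => K ⊆ S)) := by
    have h1 : ∀ S ∈ 𝒮.filter (fun S => K ⊆ S), (2 : ℕ) ^ (#K - #(S ∩ K)) = 1 := by
      intro S hS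
      have hKS : K ⊆ S := (Finset.mem_filter.1 hS).2
      have hSK : S ∩ K = K := Finset.inter_eq_right.2 hKS
      rw [hSK, Nat.sub_self, pow_zero]
    rw [Finset.sum_congr rfl h1, Finset.sum_const, smul_eq_mul, mul_one]
  have hout : Even (∑ S ∈ 𝒮.filter (fun S => ¬ K ⊆ S), (2 : ℕ) ^ (#K - #(S ∩ K))) := by
    refine Finset.even_sum _ ?_
    intro S hS
    have hKS : ¬ K ⊆ S := (Finset.mem_filter.1 hS).2
    have hlt : #(S ∩ K) < #K := by
      refine Finset.card_lt_card (lt_of_le_of_ne Finset.inter_subset_right ?_)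
      intro hEq
      apply hKS
      have : S ∩ K = K := hEq
      rw [← this]
      exact Finset.inter_subset_left
    have hne : #K - #(S ∩ K) ≠ 0 := by omega
    exact (Nat.even_pow' hne).2 (by decide)
  have htot : Odd (∑ S ∈ 𝒮, (2 : ℕ) ^ (#K - #(S ∩ K))) := by
    rw [hsplit, hin]
    exact hodd.add_even hout
  have hevenSum : Even (∑ R ∈ K.powerset, #(𝒮.filter (fun S => S ∩ K ⊆ R))) :=
    Finset.even_sum _ heven
  rw [hdc, hpow] at hevenSum
  exact (Nat.not_even_iff_odd.2 htot) hevenSum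

variable [Fintype α]

/-- **Kernel Lemma, odd-containment form.**  `𝔊` an up-set, `𝒮` a family, `K` ANY set contained in an odd number of
members of `𝒮` and with `S ∪ Kᶜ ∈ 𝔊` for every `S ∈ 𝒮` (every difference `K \ S` is a co-good).  Then some `T ∈ 𝔊`
contains an odd number of members of `𝒮`.  (`exists_odd_good` is the case where exactly one member contains `K`.)
[this work] -/
theorem exists_odd_good_of_oddCount (𝔊 : Finset (Finset α)) (hG : IsUpperSet (𝔊 : Set (Finset α)))
    (𝒮 : Finset (Finset α)) (K : Finset α) (hodd : Odd #(𝒮.filter (fun S => K ⊆ S)))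
    (hco : ∀ S ∈ 𝒮, S ∪ Kᶜ ∈ 𝔊) :
    ∃ T ∈ 𝔊, Odd #(𝒮.filter (fun S => S ⊆ T)) := by
  obtain ⟨R, _, hR⟩ := exists_odd_trace_of_oddCount 𝒮 K hodd
  refine ⟨Kᶜ ∪ R, ?_, ?_⟩
  · have hpos : 0 < #(𝒮.filter (fun S => S ∩ K ⊆ R)) := Nat.pos_of_ne_zero (fun h0 => by
      rw [h0] at hR; exact (Nat.not_even_iff_odd.2 hR) (by decide))
    obtain ⟨S₀, hS₀⟩ := Finset.card_pos.1 hpos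
    rw [Finset.mem_filter] at hS₀
    have hsub : S₀ ∪ Kᶜ ⊆ Kᶜ ∪ R := by
      intro x hx
      rcases Finset.mem_union.1 hx with hxS | hxK
      · exact (StaircaseKleitman.subset_compl_union_iff S₀ K R).2 hS₀.2 hxS
      · exact Finset.mem_union_left _ hxK
    exact hG hsub (hco S₀ hS₀.1)
  · have hEq : 𝒮.filter (fun S => S ⊆ Kᶜ ∪ R) = 𝒮.filter (fun S => S ∩ K ⊆ R) :=
      Finset.filter_congr (fun S _ => StaircaseKleitman.subset_compl_union_iff S K R)
    rw [hEq]; exact hR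

/-- **Co-good certificates.**  If `K` is a co-good (`Kᶜ ∈ 𝔊`) contained in an odd number of members of `𝒮`, then some
`T ∈ 𝔊` contains an odd number of members of `𝒮`. [this work] -/
theorem exists_odd_good_of_compl_mem (𝔊 : Finset (Finset α)) (hG : IsUpperSet (𝔊 : Set (Finset α)))
    (𝒮 : Finset (Finset α)) (K : Finset α) (hK : Kᶜ ∈ 𝔊) (hodd : Odd #(𝒮.filter (fun S => K ⊆ S))) :
    ∃ T ∈ 𝔊, Odd #(𝒮.filter (fun S => S ⊆ T)) :=
  exists_odd_good_of_oddCount 𝔊 hG 𝒮 K hodd (fun S _ => hG (Finset.subset_union_right : Kᶜ ⊆ S ∪ Kᶜ) hK)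

/-- The degenerate certificate `K = ∅`: if `univ ∈ 𝔊`, every subfamily of odd size has the odd target `univ`. [this work] -/
theorem exists_odd_good_of_card_odd (𝔊 : Finset (Finset α)) (huniv : (Finset.univ : Finset α) ∈ 𝔊)
    (𝒮 : Finset (Finset α)) (hodd : Odd #𝒮) : ∃ T ∈ 𝔊, Odd #(𝒮.filter (fun S => S ⊆ T)) :=
  ⟨Finset.univ, huniv, by rwa [Finset.filter_true_of_mem (fun S _ => Finset.subset_univ S)]⟩

/-- **Möbius parity below a good.**  For `T ∈ 𝔊` put `C = Tᶜ`; then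
`∑_{K ⊆ C} #{S ∈ 𝒮 : K ⊆ S} = ∑_{S ∈ 𝒮} (2 : ℕ) ^ #(S ∩ C)`, whose odd terms are exactly the members `S ⊆ T`.  Hence if `T`
contains an odd number of members, some `K ⊆ C` — a co-good, as `Kᶜ ⊇ T` — is contained in an odd number of members.
[this work] -/
theorem exists_compl_mem_oddCount_of_odd_good (𝔊 : Finset (Finset α)) (hG : IsUpperSet (𝔊 : Set (Finset α)))
    (𝒮 : Finset (Finset α)) (T : Finset α) (hT : T ∈ 𝔊) (hodd : Odd #(𝒮.filter (fun S => S ⊆ T))) :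
    ∃ K : Finset α, Kᶜ ∈ 𝔊 ∧ Odd #(𝒮.filter (fun S => K ⊆ S)) := by
  by_contra hcon
  simp only [not_exists, not_and] at hcon
  set C : Finset α := Tᶜ with hC
  have hKgood : ∀ K ∈ C.powerset, Kᶜ ∈ 𝔊 := by
    intro K hK
    have hKC : K ⊆ C := Finset.mem_powerset.1 hK
    have hTK : T ⊆ Kᶜ := by
      intro x hx
      rw [Finset.mem_compl]
      intro hxK
      have := hKC hxK
      rw [hC, Finset.mem_compl] at this
      exact this hx
    exact hG hTK hT
  have heven : ∀ K ∈ C.powerset, Even #(𝒮.filter (fun S => K ⊆ S)) :=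
    fun K hK => Nat.not_odd_iff_even.1 (hcon K (hKgood K hK))
  have hdc : ∑ K ∈ C.powerset, #(𝒮.filter (fun S => K ⊆ S))
      = ∑ S ∈ 𝒮, #(C.powerset.filter (fun K => K ⊆ S)) := by
    simp_rw [Finset.card_filter]
    exact Finset.sum_comm
  have hpow : ∑ S ∈ 𝒮, #(C.powerset.filter (fun K => K ⊆ S)) = ∑ S ∈ 𝒮, (2 : ℕ) ^ #(S ∩ C) := by
    refine Finset.sum_congr rfl ?_
    intro S _
    have hEq : C.powerset.filter (fun K => K ⊆ S) = (S ∩ C).powerset := by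
      ext K
      simp only [Finset.mem_filter, Finset.mem_powerset, Finset.subset_inter_iff]
      tauto
    rw [hEq, Finset.card_powerset]
  have hsplit : ∑ S ∈ 𝒮, (2 : ℕ) ^ #(S ∩ C)
      = ∑ S ∈ 𝒮.filter (fun S => S ⊆ T), (2 : ℕ) ^ #(S ∩ C)
        + ∑ S ∈ 𝒮.filter (fun S => ¬ S ⊆ T), (2 : ℕ) ^ #(S ∩ C) :=
    (Finset.sum_filter_add_sum_filter_not 𝒮 (fun S => S ⊆ T) (fun S => (2 : ℕ) ^ #(S ∩ C))).symm
  have hin : ∑ S ∈ 𝒮.filter (fun S => S ⊆ T), (2 : ℕ) ^ #(S ∩ C) = #(𝒮.filter (fun S => S ⊆ T)) := by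
    have h1 : ∀ S ∈ 𝒮.filter (fun S => S ⊆ T), (2 : ℕ) ^ #(S ∩ C) = 1 := by
      intro S hS
      have hST : S ⊆ T := (Finset.mem_filter.1 hS).2
      have hSC : S ∩ C = ∅ := by
        rw [Finset.eq_empty_iff_forall_notMem]
        intro x hx
        rw [Finset.mem_inter, hC, Finset.mem_compl] at hx
        exact hx.2 (hST hx.1)
      rw [hSC, Finset.card_empty, pow_zero]
    rw [Finset.sum_congr rfl h1, Finset.sum_const, smul_eq_mul, mul_one]
  have hout : Even (∑ S ∈ 𝒮.filter (fun S => ¬ S ⊆ T), (2 : ℕ) ^ #(S ∩ C)) := by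
    refine Finset.even_sum _ ?_
    intro S hS
    have hST : ¬ S ⊆ T := (Finset.mem_filter.1 hS).2
    have hne : #(S ∩ C) ≠ 0 := by
      rw [Ne, Finset.card_eq_zero, Finset.eq_empty_iff_forall_notMem]
      intro hall
      apply hST
      intro x hx
      by_contra hxT
      exact hall x (Finset.mem_inter.2 ⟨hx, by rw [hC, Finset.mem_compl]; exact hxT⟩)
    exact (Nat.even_pow' hne).2 (by decide)
  have htot : Odd (∑ S ∈ 𝒮, (2 : ℕ) ^ #(S ∩ C)) := by
    rw [hsplit, hin]
    exact hodd.add_even hout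
  have hevenSum : Even (∑ K ∈ C.powerset, #(𝒮.filter (fun S => K ⊆ S))) := Finset.even_sum _ heven
  rw [hdc, hpow] at hevenSum
  exact (Nat.not_even_iff_odd.2 htot) hevenSum

/-- **The co-good parity criterion.**  For an up-set `𝔊`, a family `𝒮` has an odd target in `𝔊` iff some co-good is
contained in an odd number of members of `𝒮`. [this work] -/
theorem odd_good_iff_oddCount (𝔊 : Finset (Finset α)) (hG : IsUpperSet (𝔊 : Set (Finset α)))
    (𝒮 : Finset (Finset α)) :
    (∃ T ∈ 𝔊, Odd #(𝒮.filter (fun S => S ⊆ T))) ↔ ∃ K : Finset α, Kᶜ ∈ 𝔊 ∧ Odd #(𝒮.filter (fun S => K ⊆ S)) :=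
  ⟨fun ⟨T, hT, hodd⟩ => exists_compl_mem_oddCount_of_odd_good 𝔊 hG 𝒮 T hT hodd,
    fun ⟨K, hK, hodd⟩ => exists_odd_good_of_compl_mem 𝔊 hG 𝒮 K hK hodd⟩

/-- **Counting by co-good certificates.**  If every nonempty subfamily of `ℛ` contains, in an odd number of its members, a
common co-good of the up-set `𝔊`, then `#ℛ ≤ #𝔊` (the inclusion rows of `ℛ` against `𝔊` are GF(2)-independent).
[this work] -/
theorem card_le_card_of_cogoodOdd {𝔊 ℛ : Finset (Finset α)} (hG : IsUpperSet (𝔊 : Set (Finset α)))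
    (h : ∀ 𝒮 ⊆ ℛ, 𝒮.Nonempty → ∃ K : Finset α, Kᶜ ∈ 𝔊 ∧ Odd #(𝒮.filter (fun S => K ⊆ S))) : #ℛ ≤ #𝔊 :=
  card_le_card_of_oddTargets fun 𝒮 h𝒮 hne => by
    obtain ⟨K, hK, hodd⟩ := h 𝒮 h𝒮 hne
    exact exists_odd_good_of_compl_mem 𝔊 hG 𝒮 K hK hodd

omit [Fintype α] in
/-- **Trace classes.**  If for some `R ⊆ p` the number of members of `𝒮` with trace `S ∩ p = R` is odd, then some
`K` with `R ⊆ K ⊆ p` is contained in an odd number of members (Möbius parity on the interval `[R, p]`: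
`∑_{R ⊆ K ⊆ p} #{S : K ⊆ S} = ∑_{S ⊇ R} 2 ^ (#(S ∩ p) - #R)`, odd terms exactly at `S ∩ p = R`). [this work] -/
theorem exists_oddCount_of_odd_traceClass (𝒮 : Finset (Finset α)) (p R : Finset α) (hRp : R ⊆ p)
    (hodd : Odd #(𝒮.filter (fun S => S ∩ p = R))) :
    ∃ K ∈ p.powerset, Odd #(𝒮.filter (fun S => K ⊆ S)) := by
  by_contra hcon
  simp only [not_exists, not_and] at hcon
  -- the index set of kernels: `R ⊆ K ⊆ p`
  set 𝒦 : Finset (Finset α) := p.powerset.filter (fun K => R ⊆ K) with h𝒦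
  have heven : ∀ K ∈ 𝒦, Even #(𝒮.filter (fun S => K ⊆ S)) := by
    intro K hK
    exact Nat.not_odd_iff_even.1 (hcon K (Finset.mem_filter.1 hK).1)
  have hdc : ∑ K ∈ 𝒦, #(𝒮.filter (fun S => K ⊆ S)) = ∑ S ∈ 𝒮, #(𝒦.filter (fun K => K ⊆ S)) := by
    simp_rw [Finset.card_filter]
    exact Finset.sum_comm
  -- the inner count, per member
  have hinner : ∀ S ∈ 𝒮, #(𝒦.filter (fun K => K ⊆ S)) = if R ⊆ S then (2 : ℕ) ^ (#(S ∩ p) - #R) else 0 := by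
    intro S _
    split_ifs with hRS
    · have hEq : 𝒦.filter (fun K => K ⊆ S) = (S ∩ p).powerset.filter (fun K => R ⊆ K) := by
        ext K
        simp only [h𝒦, Finset.mem_filter, Finset.mem_powerset, Finset.subset_inter_iff]
        tauto
      rw [hEq]
      exact StaircaseKleitman.card_filter_powerset_superset R (S ∩ p) (Finset.subset_inter hRS hRp)
    · rw [Finset.card_eq_zero, Finset.filter_eq_empty_iff]
      intro K hK hKS
      exact hRS ((Finset.mem_filter.1 hK).2.trans hKS)
  have hsum : ∑ S ∈ 𝒮, #(𝒦.filter (fun K => K ⊆ S))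
      = ∑ S ∈ 𝒮, (if R ⊆ S then (2 : ℕ) ^ (#(S ∩ p) - #R) else 0) := Finset.sum_congr rfl hinner
  have hsplit : ∑ S ∈ 𝒮, (if R ⊆ S then (2 : ℕ) ^ (#(S ∩ p) - #R) else 0)
      = ∑ S ∈ 𝒮.filter (fun S => S ∩ p = R), (if R ⊆ S then (2 : ℕ) ^ (#(S ∩ p) - #R) else 0)
        + ∑ S ∈ 𝒮.filter (fun S => ¬ S ∩ p = R), (if R ⊆ S then (2 : ℕ) ^ (#(S ∩ p) - #R) else 0) :=
    (Finset.sum_filter_add_sum_filter_not 𝒮 (fun S => S ∩ p = R)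
      (fun S => if R ⊆ S then (2 : ℕ) ^ (#(S ∩ p) - #R) else 0)).symm
  have hin : ∑ S ∈ 𝒮.filter (fun S => S ∩ p = R), (if R ⊆ S then (2 : ℕ) ^ (#(S ∩ p) - #R) else 0)
      = #(𝒮.filter (fun S => S ∩ p = R)) := by
    have h1 : ∀ S ∈ 𝒮.filter (fun S => S ∩ p = R), (if R ⊆ S then (2 : ℕ) ^ (#(S ∩ p) - #R) else 0) = 1 := by
      intro S hS
      have hSR : S ∩ p = R := (Finset.mem_filter.1 hS).2
      have hRS : R ⊆ S := by rw [← hSR]; exact Finset.inter_subset_left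
      rw [if_pos hRS, hSR, Nat.sub_self, pow_zero]
    rw [Finset.sum_congr rfl h1, Finset.sum_const, smul_eq_mul, mul_one]
  have hout : Even (∑ S ∈ 𝒮.filter (fun S => ¬ S ∩ p = R),
      (if R ⊆ S then (2 : ℕ) ^ (#(S ∩ p) - #R) else 0)) := by
    refine Finset.even_sum _ ?_
    intro S hS
    have hSR : ¬ S ∩ p = R := (Finset.mem_filter.1 hS).2
    split_ifs with hRS
    · have hRsub : R ⊆ S ∩ p := Finset.subset_inter hRS hRp
      have hlt : #R < #(S ∩ p) := Finset.card_lt_card (lt_of_le_of_ne hRsub (fun h => hSR h.symm))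
      have hne : #(S ∩ p) - #R ≠ 0 := by omega
      exact (Nat.even_pow' hne).2 (by decide)
    · exact ⟨0, rfl⟩
  have htot : Odd (∑ S ∈ 𝒮, (if R ⊆ S then (2 : ℕ) ^ (#(S ∩ p) - #R) else 0)) := by
    rw [hsplit, hin]
    exact hodd.add_even hout
  have hevenSum : Even (∑ K ∈ 𝒦, #(𝒮.filter (fun S => K ⊆ S))) := Finset.even_sum _ heven
  rw [hdc, hsum] at hevenSum
  exact (Nat.not_even_iff_odd.2 htot) hevenSum

end KernelPeeling

/-! ## Application to cell maps: sub-kernels of a compatible side are free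

For a monotone cell map `ι` the goods are `{T : ι T ∈ AC, ι Tᶜ = ⊥}`.  If a side `S` and a set `p` satisfy the two
lattice conditions `upAC (ι S) (ι pᶜ)` (every cell above `ι S` and `ι pᶜ` is AC) and `downBot (ι Sᶜ) (ι p)` (the only
cell below `ι Sᶜ` and `ι p` is `⊥`), then EVERY `K ⊆ p` has `S ∪ Kᶜ` good — the co-good condition of the kernel lemma
holds for all sub-kernels of `p` at once, and only the parity of containment remains.  For the single-source family of
the memo (a-lobes, and the sides `K1[ab|cy], K2[ab|cy], K4[ab], K5[ab], K4s[ay|bc]` of the five weight-two kinds) and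
`p` an `a→b` lobe (cells `(ab|c|y ; a|bcy)`) the two conditions hold for every member type (`compatible_bLobe_table`,
a `decide`);
hence (`exists_odd_good_of_odd_traceClass`) a subfamily one of whose trace classes on some `a→b` lobe is odd has an odd
target. -/

namespace TwoCopyMono

open Finset FourPointAtoms KernelPeeling

variable {γ : Type} [Fintype γ] [DecidableEq γ]

/-- **Free sub-kernels.**  If `upAC (ι S) (ι pᶜ)` and `downBot (ι Sᶜ) (ι p)`, then `S ∪ Kᶜ` is good for every
`K ⊆ p`. [this work] -/
theorem union_compl_mem_goods_of_compatible (ι : Finset γ → Fin 15)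
    (hmono : ∀ A B : Finset γ, A ⊆ B → ple (ι A) (ι B) = true) {S p K : Finset γ} (hK : K ⊆ p)
    (hup : upAC (ι S) (ι pᶜ) = true) (hdown : downBot (ι Sᶜ) (ι p) = true) : S ∪ Kᶜ ∈ goods ι := by
  unfold goods
  rw [Finset.mem_filter]
  refine ⟨Finset.mem_univ _, ?_, ?_⟩
  · have h1 : ple (ι S) (ι (S ∪ Kᶜ)) = true := hmono _ _ Finset.subset_union_left
    have h2 : ple (ι pᶜ) (ι (S ∪ Kᶜ)) = true :=
      hmono _ _ ((Finset.compl_subset_compl.2 hK).trans Finset.subset_union_right)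
    unfold upAC at hup
    exact of_decide_eq_true hup _ h1 h2
  · have hsub1 : (S ∪ Kᶜ)ᶜ ⊆ Sᶜ := Finset.compl_subset_compl.2 Finset.subset_union_left
    have hsub2 : (S ∪ Kᶜ)ᶜ ⊆ p := by
      intro x hx
      rw [Finset.mem_compl, Finset.mem_union, not_or, Finset.mem_compl, not_not] at hx
      exact hK hx.2
    have h1 : ple (ι (S ∪ Kᶜ)ᶜ) (ι Sᶜ) = true := hmono _ _ hsub1
    have h2 : ple (ι (S ∪ Kᶜ)ᶜ) (ι p) = true := hmono _ _ hsub2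
    unfold downBot at hdown
    exact of_decide_eq_true hdown _ h1 h2

/-- **Odd containment inside a compatible set gives an odd target.** [this work] -/
theorem exists_odd_good_of_subkernel (ι : Finset γ → Fin 15)
    (hmono : ∀ A B : Finset γ, A ⊆ B → ple (ι A) (ι B) = true) (𝒮 : Finset (Finset γ)) {p K : Finset γ}
    (hK : K ⊆ p) (hcompat : ∀ S ∈ 𝒮, upAC (ι S) (ι pᶜ) = true ∧ downBot (ι Sᶜ) (ι p) = true)
    (hodd : Odd #(𝒮.filter (fun S => K ⊆ S))) : ∃ T ∈ goods ι, Odd #(𝒮.filter (fun S => S ⊆ T)) :=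
  exists_odd_good_of_oddCount (goods ι) (goods_upper ι hmono) 𝒮 K hodd
    (fun S hS => union_compl_mem_goods_of_compatible ι hmono hK (hcompat S hS).1 (hcompat S hS).2)

/-- **Odd trace class on a compatible set gives an odd target.**  If every member of `𝒮` is compatible with `p` and some
trace class `{S ∈ 𝒮 : S ∩ p = R}` is odd, then `𝒮` has an odd target among the goods of `ι`. [this work] -/
theorem exists_odd_good_of_odd_traceClass (ι : Finset γ → Fin 15)
    (hmono : ∀ A B : Finset γ, A ⊆ B → ple (ι A) (ι B) = true) (𝒮 : Finset (Finset γ)) (p R : Finset γ)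
    (hcompat : ∀ S ∈ 𝒮, upAC (ι S) (ι pᶜ) = true ∧ downBot (ι Sᶜ) (ι p) = true)
    (hodd : Odd #(𝒮.filter (fun S => S ∩ p = R))) : ∃ T ∈ goods ι, Odd #(𝒮.filter (fun S => S ⊆ T)) := by
  by_cases hRp : R ⊆ p
  · obtain ⟨K, hK, hK'⟩ := exists_oddCount_of_odd_traceClass 𝒮 p R hRp hodd
    exact exists_odd_good_of_subkernel ι hmono 𝒮 (Finset.mem_powerset.1 hK) hcompat hK'
  · exfalso
    have h0 : 𝒮.filter (fun S => S ∩ p = R) = ∅ := by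
      rw [Finset.filter_eq_empty_iff]
      intro S _ hSR
      exact hRp (by rw [← hSR]; exact Finset.inter_subset_right)
    rw [h0, Finset.card_empty] at hodd
    exact (Nat.not_even_iff_odd.2 hodd) (by decide)

/-- **Compatibility table (kernel computation)** for the oriented types (cell; co-cell) of the SINGLE-SOURCE family at
source `a` (memo §2) — the two `a`-lobes `Pa>b = (ab|c|y ; a|bcy) = (6,7)`, `Pa>c = (ac|b|y ; a|bcy) = (5,7)` and the sides
`K1[ab|cy] = (11,9)`, `K2[ab|cy] = (11,8)`, `K4[ab] = (6,8)`, `K5[ab] = (6,1)`, `K4s[ay|bc] = (8,1)` of the five weight-two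
kinds: every type is compatible with an `a→b` lobe (`upAC h (a|bcy)`, `downBot l (ab|c|y)`), and every type except
`K1[ab|cy]` is compatible with an `a→c` lobe (`downBot l (ac|b|y)`). [this work] -/
theorem compatible_bLobe_table :
    (∀ q ∈ ({(6, 7), (5, 7), (11, 9), (11, 8), (6, 8), (6, 1), (8, 1)} : Finset (Fin 15 × Fin 15)),
        upAC q.1 7 = true ∧ downBot q.2 6 = true) ∧
      (∀ q ∈ ({(6, 7), (5, 7), (11, 9), (11, 8), (6, 8), (6, 1), (8, 1)} : Finset (Fin 15 × Fin 15)), q ≠ (11, 9) →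
        upAC q.1 7 = true ∧ downBot q.2 5 = true) := by
  decide +kernel

/-- **Lobe-trace certificate for the single-source family.**  Let `ι` be a monotone cell map, `𝒮` a family of sets
whose (cell, co-cell) types are single-source types, and `p` an `a→b` lobe (`ι p = ab|c|y`, `ι pᶜ = a|bcy`).  If some
trace class of `𝒮` on `p` is odd, then some good of `ι` contains an odd number of members of `𝒮`. [this work] -/
theorem exists_odd_good_of_bLobe_trace (ι : Finset γ → Fin 15)
    (hmono : ∀ A B : Finset γ, A ⊆ B → ple (ι A) (ι B) = true) (𝒮 : Finset (Finset γ))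
    (htypes : ∀ S ∈ 𝒮, (ι S, ι Sᶜ) ∈ ({(6, 7), (5, 7), (11, 9), (11, 8), (6, 8), (6, 1), (8, 1)} : Finset (Fin 15 × Fin 15)))
    (p R : Finset γ) (hp : ι p = 6) (hpc : ι pᶜ = 7)
    (hodd : Odd #(𝒮.filter (fun S => S ∩ p = R))) : ∃ T ∈ goods ι, Odd #(𝒮.filter (fun S => S ⊆ T)) := by
  refine exists_odd_good_of_odd_traceClass ι hmono 𝒮 p R (fun S hS => ?_) hodd
  have h := compatible_bLobe_table.1 (ι S, ι Sᶜ) (htypes S hS)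
  rw [hp, hpc]
  exact h

/-- The same for an `a→c` lobe (`ι p = ac|b|y`, `ι pᶜ = a|bcy`), for families avoiding the type `K1[ab|cy]`. [this work] -/
theorem exists_odd_good_of_cLobe_trace (ι : Finset γ → Fin 15)
    (hmono : ∀ A B : Finset γ, A ⊆ B → ple (ι A) (ι B) = true) (𝒮 : Finset (Finset γ))
    (htypes : ∀ S ∈ 𝒮, (ι S, ι Sᶜ) ∈ ({(6, 7), (5, 7), (11, 9), (11, 8), (6, 8), (6, 1), (8, 1)} : Finset (Fin 15 × Fin 15)) ∧
      (ι S, ι Sᶜ) ≠ (11, 9)) (p R : Finset γ)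
    (hp : ι p = 5) (hpc : ι pᶜ = 7)
    (hodd : Odd #(𝒮.filter (fun S => S ∩ p = R))) : ∃ T ∈ goods ι, Odd #(𝒮.filter (fun S => S ⊆ T)) := by
  refine exists_odd_good_of_odd_traceClass ι hmono 𝒮 p R (fun S hS => ?_) hodd
  have h := compatible_bLobe_table.2 (ι S, ι Sᶜ) (htypes S hS).1 (htypes S hS).2
  rw [hp, hpc]
  exact h

end TwoCopyMono

end Summit.CriticalPhenomena.PercolationContinuityZ3.Theorems
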